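import Literature.Analysis.FluidPDE.TorusClassicalH3Balance
import Literature.Analysis.FunctionSpaces.TorusConvectionLaplacianNormSq
import HarnessLib

/-!
# The `L²_t H⁴` smoothing bound of classical Navier–Stokes solutions on `T³` under an `H³` bound

Analysis/FluidPDE proof file (theorems only; no definitions, no named facts), sequel of
`TorusClassicalNSH2Smoothing.lean` / `TorusClassicalNSH3Smoothing.lean` (the pointwise-in-time `H²` and
`H³` smoothing estimates), `TorusClassicalH3Balance.lean` (the balance `d/dt ½‖∇Δu‖₂²` and its flux bound)
and `FunctionSpaces/TorusConvectionLaplacianNormSq.lean`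
(`‖Δ((u·∇)u)‖₂² ≤ C (‖∇u‖₂² + ‖Δu‖₂²)(‖Δu‖₂² + ‖∇Δu‖₂²)` on `T³`). For a classical solution `(u, p)` of
the forced incompressible Navier–Stokes system on `T^d × [a, a + τ]`, `card d = 3`, `ν > 0`, with
zero-mean velocity slices, the main theorem
`Torus.IsClassicalNSSolutionOn.intervalIntegral_norm_laplacian_laplacian_sq_le_of_le` is the
TIME-INTEGRATED form of the `k = 3` step of the regularity ladder:

`sup_{[a,a+τ]} ‖∇u‖₂² ≤ E₁`, `sup ‖Δu‖₂² ≤ Y₁`, `sup ‖∇Δu‖₂² ≤ Z₁`, `sup ‖Δf‖₂² ≤ G₂`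
  ⟹ `∫ₐ^{a+τ} ‖Δ²u(s)‖₂² ds ≤ C(d, ν, E₁, Y₁, Z₁, G₂, τ)`,

with a constant independent of `a` and of the solution (Robinson–Rodrigo–Sadowski 2016, Thm 7.1: the
differential inequality (7.3) `d/dt ‖u‖²_{H^k} + ν‖u‖²_{H^{k+1}} ≤ c ‖u‖²_{H^k} ‖u‖²_{H^k}`, `k = 3`,
integrated in time once `sup ‖u‖_{H³}` is known — the bound `u ∈ L²(0, T; H^{k+1})` of the induction;
Constantin–Foias 1988, Thm 10.6, the periodic case). It is the quantity through which a continuation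
argument restarts a local existence theorem from a time of controlled `H⁴` norm (chosen by Chebyshev).

Proof road, `Z = ‖∇Δu‖₂²`, `W = ‖Δ²u‖₂²`: (i) `(½Z)' = −νW + ∫ ⟪(u·∇)u − f, Δ³u⟫ ≤ −(ν/2)W + B`
with the constant `B = ν⁻¹ (G₂ + C (E₁ + Y₁)(Y₁ + Z₁))` (`….hasDerivWithinAt_half_gradNormSq_laplacian`,
`….gradNormSq_laplacian_flux_le`, `Torus.integral_norm_laplacian_convect_self_sq_le`); (ii) `W` is
continuous on `[a, a + τ]` (joint smoothness of `Δ²u`, `Torus.IsSmoothSpaceTimeOn.continuousOn_integral`),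
so `I(s) = ∫ₐˢ W` has derivative `W(s)` within `[a, a + τ]` (FTC, `intervalIntegral.integral_hasDerivWithinAt_right`
for the filter pair `FTCFilter.nhdsIcc`); (iii) the Lyapunov function `φ = ½Z + (ν/2) I − B (s − a)` has
`φ' ≤ 0`, whence `φ(a + τ) ≤ φ(a)` by the fencing lemma (`image_le_of_deriv_right_le_deriv_boundary`), i.e.
`(ν/2) ∫ₐ^{a+τ} W ≤ ½Z(a) + Bτ ≤ ½Z₁ + Bτ`.
Deliberately NOT here: the pointwise `H⁴` smoothing estimate, higher levels of the ladder, time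
derivatives, existence of solutions.

## Mathlib / tree search

Tree (reused): `Torus.IsClassicalNSSolutionOn.hasDerivWithinAt_half_gradNormSq_laplacian`,
`….gradNormSq_laplacian_flux_le` (`TorusClassicalH3Balance`), `Torus.integral_norm_laplacian_convect_self_sq_le`
(`TorusConvectionLaplacianNormSq`), `Torus.IsSmoothSpaceTimeOn.laplacian`, `….inner`,
`….continuousOn_integral` (`TorusSpaceTime`); Mathlib `intervalIntegral.integral_hasDerivWithinAt_right`,
`intervalIntegral.FTCFilter.nhdsIcc`, `image_le_of_deriv_right_le_deriv_boundary`. The FTC-within-`Icc`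
step is the pattern of `Literature.Analysis.ODE.hasDerivWithinAt_integral_Icc` (`ODE/LiouvilleGreenVolterraBound`,
not imported here). Searched `intervalIntegral_norm_laplacian`, `integral_norm_laplacian_laplacian`,
`in a..(a + τ), (∫ x, ‖` for classical torus solutions: no time-integrated `H⁴` bound in the tree.

## References

* J. C. Robinson, J. L. Rodrigo, W. Sadowski, *The Three-Dimensional Navier–Stokes Equations*,
  CUP 2016, Thm 7.1 ((7.3)), Thm 7.5. [RobinsonRodrigoSadowskiCUP2016]
* P. Constantin, C. Foias, *Navier–Stokes Equations*, Univ. Chicago Press 1988, Ch. 10,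
  Thm 10.6 (periodic case). [ConstantinFoiasNSE1988]
-/

noncomputable section

open MeasureTheory Set Function Filter
open scoped ContDiff InnerProductSpace RealInnerProductSpace Topology NNReal

namespace Literature.Analysis.FluidPDE

open Literature.Analysis.FunctionSpaces

variable {d : Type*} [Fintype d] [DecidableEq d]

/-! ### The time-integrated smoothing estimate -/

/-- **`L²_t H⁴` bound of classical Navier–Stokes solutions on `T³` under an `H³` bound**
(Robinson–Rodrigo–Sadowski 2016, Thm 7.1, (7.3) with `k = 3`, integrated in time; Constantin–Foias 1988,
Thm 10.6, periodic case): on `T^d` with `card d = 3`, for `ν > 0`, levels `E₁, Y₁, Z₁` (of `‖∇u‖₂²`,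
`‖Δu‖₂²`, `‖∇Δu‖₂²`), a force level `G₂` (of `‖Δf‖₂²`) and a time lapse `τ > 0` there is a constant `C`
such that for EVERY classical solution `(u, p)` of the Navier–Stokes system with force `f` on
`[a, a + τ] × T^d` whose velocity slices have zero mean, `‖∇u(t)‖₂² ≤ E₁`, `∫ ‖Δu(t)‖² ≤ Y₁`,
`‖∇Δu(t)‖₂² ≤ Z₁` and `∫ ‖Δf(t)‖² ≤ G₂` for `t ∈ [a, a + τ]`, one has
`∫ₐ^{a+τ} (∫ ‖ΔΔu(s)‖²) ds ≤ C` — uniformly in `a` and in the solution; explicitly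
`C = (2/ν)(½ max Z₁ 0 + Bτ)`, `B = ν⁻¹ (G₂ + C₃ (E₁ + Y₁)(Y₁ + Z₁))` (levels replaced by their positive
parts). Proof: the `H³` balance `(½‖∇Δu‖₂²)' = −ν‖Δ²u‖₂² + ∫ ⟪(u·∇)u − f, Δ³u⟫ ≤ −(ν/2)‖Δ²u‖₂² + B`
(`hasDerivWithinAt_half_gradNormSq_laplacian`, `gradNormSq_laplacian_flux_le`,
`Torus.integral_norm_laplacian_convect_self_sq_le`), continuity of `s ↦ ∫ ‖Δ²u(s)‖²` (joint smoothness),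
the FTC within `[a, a + τ]` for its primitive, and the fencing lemma for
`φ = ½‖∇Δu‖₂² + (ν/2) ∫ₐˢ ‖Δ²u‖₂² − B (s − a)`, which has `φ' ≤ 0`.
[cite: RobinsonRodrigoSadowskiCUP2016, Thm 7.1 (7.3)] -/
theorem _root_.Literature.Analysis.FunctionSpaces.Torus.IsClassicalNSSolutionOn.intervalIntegral_norm_laplacian_laplacian_sq_le_of_le
    (hd : Fintype.card d = 3) {ν : ℝ} (hν : 0 < ν) (E₁ Y₁ Z₁ G₂ : ℝ) {τ : ℝ} (hτ : 0 < τ) :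
    ∃ C : ℝ, ∀ {a : ℝ} {f u : ℝ → UnitAddTorus d → EuclideanSpace ℝ d} {p : ℝ → UnitAddTorus d → ℝ},
      Torus.IsClassicalNSSolutionOn (Icc a (a + τ)) ν f u p →
      (∀ t ∈ Icc a (a + τ), Torus.HasZeroMean (u t)) →
      (∀ t ∈ Icc a (a + τ), Torus.gradNormSq (u t) ≤ E₁) →
      (∀ t ∈ Icc a (a + τ), ∫ x, ‖Torus.laplacian (u t) x‖ ^ 2 ≤ Y₁) →
      (∀ t ∈ Icc a (a + τ), Torus.gradNormSq (Torus.laplacian (u t)) ≤ Z₁) →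
      (∀ t ∈ Icc a (a + τ), ∫ x, ‖Torus.laplacian (f t) x‖ ^ 2 ≤ G₂) →
        ∫ s in a..(a + τ), (∫ x, ‖Torus.laplacian (Torus.laplacian (u s)) x‖ ^ 2) ≤ C := by
  obtain ⟨C₃, hC₃0, hC₃⟩ := Torus.integral_norm_laplacian_convect_self_sq_le (d := d) hd
  have hν0 : ν ≠ 0 := hν.ne'
  -- the constants (all depend on `d, ν, E₁, Y₁, Z₁, G₂, τ` only)
  set E₁' : ℝ := max E₁ 0 with hE₁'
  set Y₁' : ℝ := max Y₁ 0 with hY₁'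
  set Z₁' : ℝ := max Z₁ 0 with hZ₁'
  set G₂' : ℝ := max G₂ 0 with hG₂'
  have hE₁'0 : 0 ≤ E₁' := le_max_right _ _
  have hY₁'0 : 0 ≤ Y₁' := le_max_right _ _
  have hZ₁'0 : 0 ≤ Z₁' := le_max_right _ _
  have hG₂'0 : 0 ≤ G₂' := le_max_right _ _
  set B : ℝ := ν⁻¹ * (G₂' + C₃ * (E₁' + Y₁') * (Y₁' + Z₁')) with hB
  refine ⟨2 / ν * (2⁻¹ * Z₁' + B * τ), fun {a f u p} h h0 hE hY hZ hG₂ => ?_⟩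
  set b : ℝ := a + τ with hb
  have hab : a < b := by rw [hb]; linarith
  have hU : UniqueDiffOn ℝ (Icc a b) := uniqueDiffOn_Icc hab
  -- notation for the quantities along the solution
  set Y : ℝ → ℝ := fun s => ∫ x, ‖Torus.laplacian (u s) x‖ ^ 2 with hYdef
  set Z : ℝ → ℝ := fun s => Torus.gradNormSq (Torus.laplacian (u s)) with hZdef
  set W : ℝ → ℝ := fun s => ∫ x, ‖Torus.laplacian (Torus.laplacian (u s)) x‖ ^ 2 with hWdef
  set Zh' : ℝ → ℝ := fun s => -ν * W s +
    ∫ x, ⟪Torus.convect (u s) (u s) x - f s x,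
      Torus.laplacian (Torus.laplacian (Torus.laplacian (u s))) x⟫ with hZh'
  have hY0 : ∀ s, 0 ≤ Y s := fun s => integral_nonneg fun x => sq_nonneg _
  have hZ0 : ∀ s, 0 ≤ Z s := fun s => Torus.gradNormSq_nonneg _
  have hE' : ∀ s ∈ Icc a b, Torus.gradNormSq (u s) ≤ E₁' := fun s hs => (hE s hs).trans (le_max_left _ _)
  have hY' : ∀ s ∈ Icc a b, Y s ≤ Y₁' := fun s hs => (hY s hs).trans (le_max_left _ _)
  have hZ' : ∀ s ∈ Icc a b, Z s ≤ Z₁' := fun s hs => (hZ s hs).trans (le_max_left _ _)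
  have hG₂'' : ∀ s ∈ Icc a b, ∫ x, ‖Torus.laplacian (f s) x‖ ^ 2 ≤ G₂' := fun s hs =>
    (hG₂ s hs).trans (le_max_left _ _)
  -- (i) the `H³` balance and its flux bound `(½Z)' ≤ −(ν/2) W + B`
  have hdZ : ∀ s ∈ Icc a b, HasDerivWithinAt (fun r => 2⁻¹ * Z r) (Zh' s) (Icc a b) s := fun s hs =>
    h.hasDerivWithinAt_half_gradNormSq_laplacian hab hs
  have hZh'le : ∀ s ∈ Icc a b, Zh' s ≤ -(ν / 2) * W s + B := by
    intro s hs
    have hus : Torus.IsSmooth (u s) := h.smooth_velocity.isSmooth_slice hs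
    have h1 := h.gradNormSq_laplacian_flux_le hν hab hs
    have h2 := hC₃ (u s) hus (h0 s hs)
    have h3 : C₃ * (Torus.gradNormSq (u s) + Y s) * (Y s + Z s) ≤ C₃ * (E₁' + Y₁') * (Y₁' + Z₁') := by
      have h4 : Torus.gradNormSq (u s) + Y s ≤ E₁' + Y₁' := add_le_add (hE' s hs) (hY' s hs)
      have h5 : Y s + Z s ≤ Y₁' + Z₁' := add_le_add (hY' s hs) (hZ' s hs)
      have h6 : 0 ≤ Y s + Z s := add_nonneg (hY0 s) (hZ0 s)
      calc C₃ * (Torus.gradNormSq (u s) + Y s) * (Y s + Z s) ≤ C₃ * (E₁' + Y₁') * (Y s + Z s) :=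
            mul_le_mul_of_nonneg_right (mul_le_mul_of_nonneg_left h4 hC₃0) h6
        _ ≤ C₃ * (E₁' + Y₁') * (Y₁' + Z₁') := mul_le_mul_of_nonneg_left h5 (by positivity)
    have h7 : ν⁻¹ * ((∫ x, ‖Torus.laplacian (f s) x‖ ^ 2) +
        ∫ x, ‖Torus.laplacian (Torus.convect (u s) (u s)) x‖ ^ 2) ≤ B := by
      rw [hB]
      exact mul_le_mul_of_nonneg_left (add_le_add (hG₂'' s hs) (h2.trans h3)) (inv_pos.2 hν).le
    calc Zh' s ≤ -(ν / 2) * W s + ν⁻¹ * ((∫ x, ‖Torus.laplacian (f s) x‖ ^ 2) +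
          ∫ x, ‖Torus.laplacian (Torus.convect (u s) (u s)) x‖ ^ 2) := h1
      _ ≤ -(ν / 2) * W s + B := by linarith
  -- (ii) `W` is continuous on `[a, b]`, so its primitive `I` has derivative `W` within `[a, b]`
  have hΔΔ : Torus.IsSmoothSpaceTimeOn (Icc a b) (fun t => Torus.laplacian (Torus.laplacian (u t))) :=
    (h.smooth_velocity.laplacian hU).laplacian hU
  have hWc : ContinuousOn W (Icc a b) := by
    have h1 := (hΔΔ.inner hΔΔ).continuousOn_integral (convex_Icc a b)
    refine h1.congr fun s _ => ?_
    simp only [hWdef, real_inner_self_eq_norm_sq]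
  set I : ℝ → ℝ := fun s => ∫ r in a..s, W r with hI
  -- adapted from `Literature.Analysis.ODE.hasDerivWithinAt_integral_Icc` (FTC within a compact interval)
  have hdI : ∀ s ∈ Icc a b, HasDerivWithinAt I (W s) (Icc a b) s := by
    intro s hs
    haveI : Fact (s ∈ Icc a b) := ⟨hs⟩
    have hint : IntervalIntegrable W volume a s :=
      (hWc.mono (Icc_subset_Icc_right hs.2)).intervalIntegrable_of_Icc hs.1
    exact intervalIntegral.integral_hasDerivWithinAt_right hint
      (hWc.stronglyMeasurableAtFilter_nhdsWithin measurableSet_Icc s) (hWc s hs)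
  -- (iii) the Lyapunov function `φ = ½Z + (ν/2) I − B (s − a)` is non-increasing
  set φ : ℝ → ℝ := fun s => 2⁻¹ * Z s + ν / 2 * I s - B * (s - a) with hφ
  set φ' : ℝ → ℝ := fun s => Zh' s + ν / 2 * W s - B with hφ'
  have hdφ : ∀ s ∈ Icc a b, HasDerivWithinAt φ (φ' s) (Icc a b) s := by
    intro s hs
    have h1 : HasDerivWithinAt (fun r => 2⁻¹ * Z r + ν / 2 * I r - B * (r - a))
        (Zh' s + ν / 2 * W s - B * 1) (Icc a b) s :=
      ((hdZ s hs).add ((hdI s hs).const_mul (ν / 2))).sub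
        (((hasDerivWithinAt_id s (Icc a b)).sub_const a).const_mul B)
    rw [mul_one] at h1
    exact h1
  have hφ'le : ∀ s ∈ Icc a b, φ' s ≤ 0 := by
    intro s hs
    have h1 := hZh'le s hs
    change Zh' s + ν / 2 * W s - B ≤ 0
    linarith
  have hφc : ContinuousOn φ (Icc a b) := fun s hs => (hdφ s hs).continuousWithinAt
  have hφr : ∀ s ∈ Ico a b, HasDerivWithinAt φ (φ' s) (Ici s) s := fun s hs =>
    ((hdφ s ⟨hs.1, hs.2.le⟩).mono (Icc_subset_Icc hs.1 le_rfl)).mono_of_mem_nhdsWithin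
      (Icc_mem_nhdsGE hs.2)
  have hfence := image_le_of_deriv_right_le_deriv_boundary hφc hφr
    (B := fun _ => φ a) (B' := fun _ => 0) le_rfl continuousOn_const
    (fun s _ => hasDerivWithinAt_const _ _ _) (fun s hs => hφ'le s ⟨hs.1, hs.2.le⟩)
    (right_mem_Icc.2 hab.le)
  have hfence' : φ b ≤ φ a := hfence
  -- (iv) unwind `φ b ≤ φ a`
  have hIa : I a = 0 := intervalIntegral.integral_same
  have hφa : φ a = 2⁻¹ * Z a := by
    change 2⁻¹ * Z a + ν / 2 * I a - B * (a - a) = 2⁻¹ * Z a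
    rw [hIa, sub_self, mul_zero, mul_zero, add_zero, sub_zero]
  have hφb : φ b = 2⁻¹ * Z b + ν / 2 * I b - B * τ := by
    change 2⁻¹ * Z b + ν / 2 * I b - B * (b - a) = 2⁻¹ * Z b + ν / 2 * I b - B * τ
    rw [hb, add_sub_cancel_left]
  have hkey : ν / 2 * I b ≤ 2⁻¹ * Z₁' + B * τ := by
    have h1 : 2⁻¹ * Z a ≤ 2⁻¹ * Z₁' :=
      mul_le_mul_of_nonneg_left (hZ' a (left_mem_Icc.2 hab.le)) (by norm_num)
    have h2 : 0 ≤ 2⁻¹ * Z b := mul_nonneg (by norm_num) (hZ0 b)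
    rw [hφa, hφb] at hfence'
    linarith
  calc ∫ s in a..b, W s = 2 / ν * (ν / 2 * I b) := by rw [hI]; field_simp
    _ ≤ 2 / ν * (2⁻¹ * Z₁' + B * τ) := mul_le_mul_of_nonneg_left hkey (by positivity)

end Literature.Analysis.FluidPDE

end
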